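import Mathlib

/-!
# Code lift for gadgets of direct pairs — explicit coordinatewise proof (support file)

Item `stmt-MatrixMultiplication-14308` (`FourierTwoFamiliesModP.PrimeTwoFamilies`, CKSU 2005 Conj. 4.7 with
prime cyclic hosts), line `Sketch` (capacity-gadget form), registered stub `codeLift`; siege attempt k22,
variation "explicit / elementary".

Setting.  `K` is an additive commutative group, `(P c, Q c)_{c < r}` a GADGET: finitely many pairs of finite
subsets of `K`, each pair DIRECT (`hD`: inside one pair, `(x - x') + (y - y') = 0` forces `x = x'` and
`y = y'`).  A finite set `W` of words `Fin L → Fin r` is a zero-error CODE for strong separation (`hW`): two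
distinct words `i ≠ k` of `W` have a coordinate `t` at which every cross difference `q - p`
(`p ∈ P (i t)`, `q ∈ Q (k t)`) avoids every diagonal difference `q' - p'` (`p' ∈ P c`, `q' ∈ Q c`, any
letter `c`).  The product blocks `A w = ∏ₜ P (w t)`, `B w = ∏ₜ Q (w t)` (`Fintype.piFinset`) in `Fin L → K`
then satisfy the two clauses (W), (X) of the simultaneous double product property.

Proof (elementary, one coordinate at a time; no structure beyond the group axioms is used).
* (W)  A relation `(a - a') + (b - b') = 0` between functions holds at every coordinate `t`; there it is a
  relation inside the single direct pair `(P (w t), Q (w t))`, so `a t = a' t` and `b t = b' t` by `hD`, and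
  the functions agree by extensionality.
* (X)  If `i ≠ k`, take the separating coordinate `t` given by `hW`.  At `t` the relation
  `(a t - a' t) + (b t - b' t) = 0` is rewritten, using only `u + v = 0 ↔ u = -v`, `-(u - v) = v - u` and
  `u - v = u' - v' ↔ u - u' = v - v'`, as the coincidence `b' t - a t = b t - a' t` of the cross difference
  (`a t ∈ P (i t)`, `b' t ∈ Q (k t)`) with a diagonal difference of the letter `j t` (`a' t ∈ P (j t)`,
  `b t ∈ Q (j t)`), which `hW` forbids.  Hence `i = k`.
-/

-- single-conjunct summit: the mandated namespace repeats `MatrixMultiplication` (summit = sub-problem).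
set_option linter.dupNamespace false

namespace Summit.MatrixMultiplication.MatrixMultiplication.Theorems.PrimeTwoFamilies.CodeLiftExplicitK22

/-- Pointwise form of a vanishing combination of differences of functions: if
`(a - a') + (b - b') = 0` in `ι → K`, then `(a t - a' t) + (b t - b' t) = 0` at every coordinate `t`
(definitional unfolding of the pointwise operations). -/
theorem apply_rel {ι K : Type*} [AddCommGroup K] {a a' b b' : ι → K}
    (h : (a - a') + (b - b') = 0) (t : ι) : (a t - a' t) + (b t - b' t) = 0 :=
  congrFun h t

/-- The one-letter rewriting step of clause (X): in an additive commutative group,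
`(a - a') + (b - b') = 0` is the coincidence of differences `b' - a = b - a'`.  Proved from the three
named identities `add_eq_zero_iff_eq_neg`, `neg_sub`, `sub_eq_sub_iff_sub_eq_sub` only. -/
theorem cross_eq_diag {K : Type*} [AddCommGroup K] {a a' b b' : K}
    (h : (a - a') + (b - b') = 0) : b' - a = b - a' :=
  -- `a - a' = -(b - b') = b' - b`, then swap the middle terms.
  have e : a - a' = b' - b := (add_eq_zero_iff_eq_neg.mp h).trans (neg_sub b b')
  sub_eq_sub_iff_sub_eq_sub.mpr e.symm

/-- **CODE LIFT** (registered stub `codeLift` of crux `stmt-MatrixMultiplication-14308`, verbatim).  If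
every letter `(P c, Q c)` is direct (`hD`) and `W` is a zero-error code for strong separation (`hW`), then
the product blocks `A w = Fintype.piFinset (fun t => P (w t))`, `B w = Fintype.piFinset (fun t => Q (w t))`
(`w ∈ W`) satisfy clause (W) (first conjunct: each block pair is direct) and clause (X) (second conjunct:
a relation `(a - a') + (b - b') = 0` with `a ∈ A i`, `a' ∈ A j`, `b ∈ B j`, `b' ∈ B k` forces `i = k`) of
the simultaneous double product property.  Explicit coordinatewise proof: (W) is `hD` at every coordinate
plus function extensionality; (X) evaluates the relation at the separating coordinate of `i ≠ k` and reads
it (`cross_eq_diag`) as a cross difference equal to a diagonal difference of the letter `j t`. -/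
theorem codeLift {K : Type*} [AddCommGroup K] [DecidableEq K] {r L : ℕ}
    (P Q : Fin r → Finset K)
    (hD : ∀ c : Fin r, ∀ x ∈ P c, ∀ x' ∈ P c, ∀ y ∈ Q c, ∀ y' ∈ Q c,
      (x - x') + (y - y') = 0 → x = x' ∧ y = y')
    (W : Finset (Fin L → Fin r))
    (hW : ∀ i ∈ W, ∀ k ∈ W, i ≠ k → ∃ t : Fin L,
      ∀ p ∈ P (i t), ∀ q ∈ Q (k t), ∀ c : Fin r, ∀ p' ∈ P c, ∀ q' ∈ Q c, q - p ≠ q' - p') :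
    (∀ w ∈ W, ∀ a ∈ Fintype.piFinset (fun t => P (w t)), ∀ a' ∈ Fintype.piFinset (fun t => P (w t)),
      ∀ b ∈ Fintype.piFinset (fun t => Q (w t)), ∀ b' ∈ Fintype.piFinset (fun t => Q (w t)),
        (a - a') + (b - b') = 0 → a = a' ∧ b = b') ∧
    (∀ i ∈ W, ∀ j ∈ W, ∀ k ∈ W,
      ∀ a ∈ Fintype.piFinset (fun t => P (i t)), ∀ a' ∈ Fintype.piFinset (fun t => P (j t)),
      ∀ b ∈ Fintype.piFinset (fun t => Q (j t)), ∀ b' ∈ Fintype.piFinset (fun t => Q (k t)),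
        (a - a') + (b - b') = 0 → i = k) := by
  refine ⟨?_, ?_⟩
  · -- (W): the relation holds coordinatewise inside the direct pair `(P (w t), Q (w t))`.
    intro w _ a ha a' ha' b hb b' hb' h
    have key : ∀ t : Fin L, a t = a' t ∧ b t = b' t := fun t =>
      hD (w t) (a t) (Fintype.mem_piFinset.mp ha t) (a' t) (Fintype.mem_piFinset.mp ha' t)
        (b t) (Fintype.mem_piFinset.mp hb t) (b' t) (Fintype.mem_piFinset.mp hb' t) (apply_rel h t)
    exact ⟨funext fun t => (key t).1, funext fun t => (key t).2⟩
  · -- (X): equality of words is decidable; rule out `i ≠ k` at its separating coordinate.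
    intro i hi j _ k hk a ha a' ha' b hb b' hb' h
    by_contra hik
    obtain ⟨t, ht⟩ := hW i hi k hk hik
    exact ht (a t) (Fintype.mem_piFinset.mp ha t) (b' t) (Fintype.mem_piFinset.mp hb' t) (j t)
      (a' t) (Fintype.mem_piFinset.mp ha' t) (b t) (Fintype.mem_piFinset.mp hb t)
      (cross_eq_diag (apply_rel h t))

end Summit.MatrixMultiplication.MatrixMultiplication.Theorems.PrimeTwoFamilies.CodeLiftExplicitK22
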